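import Summits.Ventures.CertifiedManyBodySolver.Downfold.EmeryShapeWindowClosure
import Summits.Ventures.CertifiedManyBodySolver.Downfold.EmeryOxygenHoppingLipschitz
import HarnessLib

/-!
# THE MARGIN LEVERS: `t_pp ↑` at fixed `t_pp′` and `t_pp′ ↑` at fixed `t_pp` make the fixed-doping one-band `t′/t` MORE negative whenever the
# fixed-energy slope beats `4·|dopingDisc|/T²` — the two remaining coordinate directions of object E, signed under ONE checkable rational inequality
# each (INFL-3to1-B §B.87 (a)–(d))

Venture CertifiedManyBodySolver, cell `pub/hubbard-downfold` (stage S1; INFLATION-RULES-3to1-B §B.87), seat hubbard-downfold-mod-4 (technique B = band level,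
g35); namespace `Summit.Ventures.CertifiedManyBodySolver.Downfold.Emery`. Everything PROVED (0 sorry, no definition). WHAT THIS IS NOT: a statement about any
material; `U = 0` one-body kinematics of the σ (d–p_x–p_y + t_pp, t_pp′) model; no number lives here.

§B.85 (l) recorded that `t_pp` ALONE (at fixed `t_pp′ > 0`) is not signed by scaling, and §B.85 (m) signed `t_pp′` alone only on the cuprate side of the
doping discriminant. Both directions have two channels: a FIXED-ENERGY channel with a definite sign and an exact size (the shape is `−N/(D + 2N)`), and an
ENERGY channel whose size is bounded by the exact difference formula `fsRatio(ε₂) − fsRatio(ε₁) = −(ε₂ − ε₁)·dopingDisc/(T₁T₂)` (§B.86 (e)) times the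
4-Lipschitz oxygen moduli of the Fermi energy (§B.85 (q)–(r)). Comparing the two gives levers under an explicit MARGIN:

* §1 exact fixed-energy differences: `fsRatio(b′; E) − fsRatio(b; E) = −D·(N(b′) − N(b))/(T·T′)` (`fsRatio_sub_fsRatio_tpp_at_eq`) and
  `fsRatio(c′; E) − fsRatio(c; E) = −(N(c′)D(c) − N(c)D(c′))/(T·T′)` (`fsRatio_sub_fsRatio_tppP_at_eq`).
* §2 **THE MARGIN `t_pp` LEVER** (`fsRatio_fermiEnergyOf_anti_tpp_of_margin`): rows `θ = (Δ, a, b, c)`, `θ′ = (Δ, a, b′, c)`, `0 < b ≤ b′`, `0 ≤ c ≤ b`; a window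
  `[p, q] ∋ ε_F(θ), ε_F(θ′)` (`0 ≤ p`, regime `c(Δ + 2q) ≤ a²`); `−M ≤ dopingDisc(θ′; p, p)`, `0 ≤ M`; and the margin
  **`4M·T(θ; q)·T(θ′; q) ≤ 2a²·(Δ + p)(a² − cq)·T(θ′; p)²`** ⇒ **`R(θ′) ≤ R(θ)`**: MORE DIRECT OXYGEN HOPPING, MORE NEGATIVE `t′/t`, at fixed `t_pp′`.
  (rise of the energy channel `≤ 4βM/T(θ′; p)²` since `ε_F(θ′) − ε_F(θ) ∈ [0, 4β]`; drop of the fixed-energy channel `≥ 2a²βD₀/(T(θ; q)T(θ′; q))`.)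
* §3 **THE MARGIN `t_pp′` LEVER** (`fsRatio_fermiEnergyOf_anti_tppP_of_margin`): rows `θ = (Δ, a, b, c)`, `θ′ = (Δ, a, b, c′)`, `0 ≤ c ≤ c′ ≤ b`; window as above
  (regime `c′(Δ + 2q) ≤ a²`, `c′q ≤ a²`); `dopingDisc(θ′; q, q) ≤ M`, `0 ≤ M`; margin
  **`4M·T(θ; q)·T(θ′; q) ≤ [(Δ + p)(a² − cq)·(2a² − 2c′q) + N(θ; p)·(Δ + p)·p]·T(θ′; p)²`** ⇒ **`R(θ′) ≤ R(θ)`** — the UNCONDITIONAL-IN-SIGN form of §B.85 (m):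
  on the cuprate side (`M = 0`) it is free; on the other side the fixed-energy drop must beat the energy-channel rise.
* §4 USE (§B.87 (e), `EmeryShapeTrueCornerRule`): with all four coordinate directions signed on a typed box (Δ, t_pd certificate-free; t_pp, t_pp′ under box-wide
  margins read from the same point brackets), the fixed-doping `t′/t` of EVERY member lies between its values at the two TRUE corners `(Δ₁, a₁, b₂, c₂)` and
  `(Δ₂, a₂, b₁, c₁)` — no virtual-corner inflation.

Sources: three-band model [HybertsenSchluterChristensen1989, Eq. (1)]; contour form [AndersenEtAl1995, §6]; arithmetic [folklore].
-/

noncomputable section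

namespace Summit.Ventures.CertifiedManyBodySolver.Downfold.Emery

open Real Set

/-! ## §1 Exact fixed-energy differences -/

/-- `fsRatio(b′; E) − fsRatio(b; E) = −D·(N(b′) − N(b))/(T(b)·T(b′))` at a common energy (`T ≠ 0` at both rows). [folklore] -/
theorem fsRatio_sub_fsRatio_tpp_at_eq {Δ a b b' c E : ℝ} (hT : fsD Δ a c E + 2 * fsN a b c E ≠ 0) (hT' : fsD Δ a c E + 2 * fsN a b' c E ≠ 0) :
    fsRatio Δ a b' c E - fsRatio Δ a b c E =
      -(fsD Δ a c E * (fsN a b' c E - fsN a b c E)) / ((fsD Δ a c E + 2 * fsN a b c E) * (fsD Δ a c E + 2 * fsN a b' c E)) := by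
  unfold fsRatio
  rw [div_sub_div _ _ hT' hT, div_eq_div_iff (mul_ne_zero hT' hT) (mul_ne_zero hT hT')]
  ring

/-- `fsRatio(c′; E) − fsRatio(c; E) = −(N(c′)D(c) − N(c)D(c′))/(T(c)·T(c′))` at a common energy (`T ≠ 0` at both rows). [folklore] -/
theorem fsRatio_sub_fsRatio_tppP_at_eq {Δ a b c c' E : ℝ} (hT : fsD Δ a c E + 2 * fsN a b c E ≠ 0) (hT' : fsD Δ a c' E + 2 * fsN a b c' E ≠ 0) :
    fsRatio Δ a b c' E - fsRatio Δ a b c E =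
      -(fsN a b c' E * fsD Δ a c E - fsN a b c E * fsD Δ a c' E) / ((fsD Δ a c E + 2 * fsN a b c E) * (fsD Δ a c' E + 2 * fsN a b c' E)) := by
  unfold fsRatio
  rw [div_sub_div _ _ hT' hT, div_eq_div_iff (mul_ne_zero hT' hT) (mul_ne_zero hT hT')]
  ring

/-- `N(b′) − N(b) = (b′ − b)(2a² + E(b + b′))` at a common energy and `t_pp′`. [folklore] -/
theorem fsN_sub_fsN_tpp (a b b' c E : ℝ) : fsN a b' c E - fsN a b c E = (b' - b) * (2 * a ^ 2 + E * (b + b')) := by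
  unfold fsN; ring

/-- `N(c′)D(c) − N(c)D(c′) = D(c)·(c′ − c)(2a² − E(c + c′)) + N(c)·(Δ + E)E(c′ − c)` at a common energy and `t_pp`. [folklore] -/
theorem cross_tppP_eq (Δ a b c c' E : ℝ) :
    fsN a b c' E * fsD Δ a c E - fsN a b c E * fsD Δ a c' E =
      fsD Δ a c E * ((c' - c) * (2 * a ^ 2 - E * (c + c'))) + fsN a b c E * ((Δ + E) * E * (c' - c)) := by
  unfold fsN fsD; ring

/-! ## §1b Scalar bookkeeping lemmas (keep the big terms atomic) -/

/-- Energy-channel bound, rising form: `−(x·d)/(T₁T₂) ≤ 4βM/T_p²` for `0 ≤ x ≤ 4β`, `−M ≤ d`, `0 ≤ M`, `0 < T_p ≤ T₁, T₂`. [folklore] -/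
theorem energyChannel_bound {x d M β Tp T₁ T₂ : ℝ} (hM0 : 0 ≤ M) (hd : -M ≤ d) (hx0 : 0 ≤ x) (hx : x ≤ 4 * β) (hTp : 0 < Tp)
    (h1 : Tp ≤ T₁) (h2 : Tp ≤ T₂) : -(x * d) / (T₁ * T₂) ≤ 4 * β * M / Tp ^ 2 := by
  have hT₁ : 0 < T₁ := lt_of_lt_of_le hTp h1
  have hT₂ : 0 < T₂ := lt_of_lt_of_le hTp h2
  have hnum : -(x * d) ≤ 4 * β * M := by
    have h3 : -(x * d) ≤ x * M := by nlinarith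
    have h4 : x * M ≤ 4 * β * M := mul_le_mul_of_nonneg_right hx hM0
    linarith
  have hden : Tp ^ 2 ≤ T₁ * T₂ := by rw [pow_two]; exact mul_le_mul h1 h2 hTp.le hT₁.le
  calc -(x * d) / (T₁ * T₂) ≤ 4 * β * M / (T₁ * T₂) := div_le_div_of_nonneg_right hnum (mul_pos hT₁ hT₂).le
    _ ≤ 4 * β * M / Tp ^ 2 := div_le_div_of_nonneg_left (by nlinarith) (pow_pos hTp 2) hden

/-- Energy-channel bound, the other sign: `(x·d)/(T₁T₂) ≤ 4γM/T_p²` for `0 ≤ x ≤ 4γ`, `d ≤ M`, `0 ≤ M`, `0 < T_p ≤ T₁, T₂`. [folklore] -/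
theorem energyChannel_bound' {x d M γ Tp T₁ T₂ : ℝ} (hM0 : 0 ≤ M) (hd : d ≤ M) (hx0 : 0 ≤ x) (hx : x ≤ 4 * γ) (hTp : 0 < Tp)
    (h1 : Tp ≤ T₁) (h2 : Tp ≤ T₂) : x * d / (T₁ * T₂) ≤ 4 * γ * M / Tp ^ 2 := by
  have h := energyChannel_bound (d := -d) hM0 (by linarith) hx0 hx hTp h1 h2
  simpa [mul_neg, neg_neg] using h

/-- Fixed-energy-channel bound: `−(D·n)/(T·T′) ≤ −(D₀·n₀)/(T_q·T_q′)` for `0 ≤ D₀ ≤ D`, `0 ≤ n₀ ≤ n`, `0 < T ≤ T_q`, `0 < T′ ≤ T_q′`. [folklore] -/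
theorem fixedChannel_bound {D D₀ n n₀ T T' Tq Tq' : ℝ} (hD0 : 0 ≤ D₀) (hD : D₀ ≤ D) (hn0 : 0 ≤ n₀) (hn : n₀ ≤ n) (hT : 0 < T) (hT' : 0 < T')
    (hTq : T ≤ Tq) (hTq' : T' ≤ Tq') : -(D * n) / (T * T') ≤ -(D₀ * n₀) / (Tq * Tq') := by
  have hTq0 : 0 < Tq := lt_of_lt_of_le hT hTq
  have hTq0' : 0 < Tq' := lt_of_lt_of_le hT' hTq'
  rw [neg_div, neg_div, neg_le_neg_iff]
  have hnum : D₀ * n₀ ≤ D * n := mul_le_mul hD hn hn0 (hD0.trans hD)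
  have hden : T * T' ≤ Tq * Tq' := mul_le_mul hTq hTq' hT'.le hTq0.le
  calc D₀ * n₀ / (Tq * Tq') ≤ D₀ * n₀ / (T * T') := div_le_div_of_nonneg_left (mul_nonneg hD0 hn0) (mul_pos hT hT') hden
    _ ≤ D * n / (T * T') := div_le_div_of_nonneg_right hnum (mul_pos hT hT').le

/-- Margin combination: `4βM/T_p² ≤ β·K/(T_q T_q′)` from `4M·(T_q T_q′) ≤ K·T_p²` (`β ≥ 0`, positive `T`'s). [folklore] -/
theorem margin_combine {β M K Tp Tq Tq' : ℝ} (hβ : 0 ≤ β) (hTp : 0 < Tp) (hTq : 0 < Tq) (hTq' : 0 < Tq')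
    (hm : 4 * M * (Tq * Tq') ≤ K * Tp ^ 2) : 4 * β * M / Tp ^ 2 ≤ β * K / (Tq * Tq') := by
  rw [div_le_div_iff₀ (pow_pos hTp 2) (mul_pos hTq hTq')]
  calc 4 * β * M * (Tq * Tq') = β * (4 * M * (Tq * Tq')) := by ring
    _ ≤ β * (K * Tp ^ 2) := mul_le_mul_of_nonneg_left hm hβ
    _ = β * K * Tp ^ 2 := by ring

/-- `2a²(b′ − b) ≤ N(b′) − N(b)` at a common energy `E ≥ 0` (`0 ≤ b ≤ b′`). [folklore] -/
theorem two_sq_mul_le_fsN_sub {a b b' c E : ℝ} (hE : 0 ≤ E) (hb : 0 ≤ b) (hbb : b ≤ b') :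
    2 * a ^ 2 * (b' - b) ≤ fsN a b' c E - fsN a b c E := by
  rw [fsN_sub_fsN_tpp]
  have h1 : 0 ≤ E * (b + b') := mul_nonneg hE (by linarith)
  have h2 : 0 ≤ b' - b := by linarith
  nlinarith

/-- `D` on the window: `(Δ + p)(a² − cq) ≤ fsD(E)` for `p ≤ E ≤ q`, `c ≥ 0`, `Δ + p ≥ 0`, `cq ≤ a²`. [folklore] -/
theorem fsD_window_lower {Δ a c p q E : ℝ} (hc : 0 ≤ c) (hΔp : 0 ≤ Δ + p) (hreg : c * q ≤ a ^ 2) (hpE : p ≤ E) (hEq : E ≤ q) :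
    (Δ + p) * (a ^ 2 - c * q) ≤ fsD Δ a c E := by
  unfold fsD
  have h1 : a ^ 2 - c * q ≤ a ^ 2 - c * E := by nlinarith
  exact mul_le_mul (by linarith) h1 (by linarith) (by linarith)

/-- `N` is non-decreasing in the energy (`0 ≤ c ≤ b`). [folklore] -/
theorem fsN_mono_energy {a b c e e' : ℝ} (hc : 0 ≤ c) (hcb : c ≤ b) (hee : e ≤ e') : fsN a b c e ≤ fsN a b c e' := by
  unfold fsN
  have : 0 ≤ b ^ 2 - c ^ 2 := by nlinarith
  nlinarith [mul_le_mul_of_nonneg_right hee this]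

/-! ## §2 The margin `t_pp` lever -/

section TppMargin

variable {Δ a b b' c ν p q M : ℝ}

/-- **THE MARGIN `t_pp` LEVER**: at fixed `t_pp′`, raising `t_pp` from `b` to `b′` makes the fixed-doping `t′/t` more negative whenever the fixed-energy drop
beats the energy-channel rise — one rational inequality in the two rows and a common energy window. [folklore] -/
theorem fsRatio_fermiEnergyOf_anti_tpp_of_margin (hΔ : 0 < Δ) (ha : 0 < a) (hb : 0 < b) (hbb : b ≤ b') (hc : 0 ≤ c) (hcb : c ≤ b)
    (hν0 : 0 < ν) (hν1 : ν < 1) (hp0 : 0 ≤ p) (hpE : p ≤ fermiEnergyOf Δ a b c ν) (hEq : fermiEnergyOf Δ a b' c ν ≤ q)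
    (hcapw : c * (Δ + 2 * q) ≤ a ^ 2) (hM0 : 0 ≤ M) (hM : -M ≤ dopingDisc Δ a b' c p p)
    (hmargin : 4 * M * ((fsD Δ a c q + 2 * fsN a b c q) * (fsD Δ a c q + 2 * fsN a b' c q)) ≤
      2 * a ^ 2 * ((Δ + p) * (a ^ 2 - c * q)) * (fsD Δ a c p + 2 * fsN a b' c p) ^ 2) :
    fsRatio Δ a b' c (fermiEnergyOf Δ a b' c ν) ≤ fsRatio Δ a b c (fermiEnergyOf Δ a b c ν) := by
  set E := fermiEnergyOf Δ a b c ν with hE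
  set E' := fermiEnergyOf Δ a b' c ν with hE'
  have hb' : 0 < b' := lt_of_lt_of_le hb hbb
  have hcb' : c ≤ b' := hcb.trans hbb
  have hβ : 0 ≤ b' - b := sub_nonneg.2 hbb
  -- the t_pp bracket of the Fermi energy (§B.85 (r)): E ≤ E′ ≤ E + 4(b′ − b)
  have hbr := fermiEnergyOf_tpp_shift_mem_Icc (β := b' - b) (c := c) hΔ ha.ne' hc hb.le hβ hν0 hν1
  rw [show b + (b' - b) = b' by ring, ← hE, ← hE'] at hbr
  obtain ⟨hEE', hE'E⟩ := hbr
  have hx0 : 0 ≤ E' - E := sub_nonneg.2 hEE'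
  have hx : E' - E ≤ 4 * (b' - b) := by linarith only [hE'E]
  have hEq' : E ≤ q := hEE'.trans hEq
  have hpE' : p ≤ E' := hpE.trans hEE'
  have hpq : p ≤ q := hpE.trans hEq'
  have hq0 : 0 ≤ q := hp0.trans hpq
  have hΔp : 0 ≤ Δ + p := by linarith only [hΔ, hp0]
  have hreg : c * q ≤ a ^ 2 := le_trans (mul_le_mul_of_nonneg_left (by linarith only [hΔ, hq0]) hc) hcapw
  have hD0 : 0 ≤ (Δ + p) * (a ^ 2 - c * q) := mul_nonneg hΔp (by linarith only [hreg])
  have hDE : (Δ + p) * (a ^ 2 - c * q) ≤ fsD Δ a c E := fsD_window_lower hc hΔp hreg hpE hEq'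
  -- positivity of the T's on the window (D ≥ 0 from the regime, N > 0)
  have hDp : 0 ≤ fsD Δ a c p := le_trans hD0 (fsD_window_lower hc hΔp hreg le_rfl hpq)
  have hDE' : 0 ≤ fsD Δ a c E' := le_trans hD0 (fsD_window_lower hc hΔp hreg hpE' hEq)
  have hNb'p : 0 < fsN a b' c p := fsN_pos ha.ne' hc hcb' hb' hp0
  have hNbE : 0 < fsN a b c E := fsN_pos ha.ne' hc hcb hb (hp0.trans hpE)
  have hNb'E : 0 < fsN a b' c E := fsN_pos ha.ne' hc hcb' hb' (hp0.trans hpE)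
  have hNb'E' : 0 < fsN a b' c E' := fsN_pos ha.ne' hc hcb' hb' (hp0.trans hpE')
  have hTp' : 0 < fsD Δ a c p + 2 * fsN a b' c p := by linarith only [hDp, hNb'p]
  have hTbE : 0 < fsD Δ a c E + 2 * fsN a b c E := by linarith only [hD0, hDE, hNbE]
  have hTb'E : 0 < fsD Δ a c E + 2 * fsN a b' c E := by linarith only [hD0, hDE, hNb'E]
  have hTb'E' : 0 < fsD Δ a c E' + 2 * fsN a b' c E' := by linarith only [hDE', hNb'E']
  have hmono_b'_pE : fsD Δ a c p + 2 * fsN a b' c p ≤ fsD Δ a c E + 2 * fsN a b' c E := fsT_mono_on_window hc hcb' hcapw hpE hEq'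
  have hmono_b'_pE' : fsD Δ a c p + 2 * fsN a b' c p ≤ fsD Δ a c E' + 2 * fsN a b' c E' := fsT_mono_on_window hc hcb' hcapw hpE' hEq
  have hmono_b_Eq : fsD Δ a c E + 2 * fsN a b c E ≤ fsD Δ a c q + 2 * fsN a b c q := fsT_mono_on_window hc hcb hcapw hEq' le_rfl
  have hmono_b'_Eq : fsD Δ a c E + 2 * fsN a b' c E ≤ fsD Δ a c q + 2 * fsN a b' c q := fsT_mono_on_window hc hcb' hcapw hEq' le_rfl
  -- (1) the energy channel at the row b′: rise ≤ 4βM / T(b′; p)²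
  have hdd : -M ≤ dopingDisc Δ a b' c E E' :=
    hM.trans (dopingDisc_mem_Icc_diag (Δ := Δ) (a := a) hc hcb' hp0 ⟨hpE, hEq'⟩ ⟨hpE', hEq⟩).1
  have hrise : fsRatio Δ a b' c E' - fsRatio Δ a b' c E ≤ 4 * (b' - b) * M / (fsD Δ a c p + 2 * fsN a b' c p) ^ 2 := by
    rw [fsRatio_sub_fsRatio_eq hTb'E.ne' hTb'E'.ne']
    exact energyChannel_bound hM0 hdd hx0 hx hTp' hmono_b'_pE hmono_b'_pE'
  -- (2) the fixed-energy channel at E: drop ≥ 2a²βD₀ / (T(b; q) T(b′; q))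
  have hΔN : 2 * a ^ 2 * (b' - b) ≤ fsN a b' c E - fsN a b c E := two_sq_mul_le_fsN_sub (hp0.trans hpE) hb.le hbb
  have hn0 : 0 ≤ 2 * a ^ 2 * (b' - b) := mul_nonneg (by positivity) hβ
  have hdrop : fsRatio Δ a b' c E - fsRatio Δ a b c E ≤
      -(((Δ + p) * (a ^ 2 - c * q)) * (2 * a ^ 2 * (b' - b))) / ((fsD Δ a c q + 2 * fsN a b c q) * (fsD Δ a c q + 2 * fsN a b' c q)) := by
    rw [fsRatio_sub_fsRatio_tpp_at_eq hTbE.ne' hTb'E.ne']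
    exact fixedChannel_bound hD0 hDE hn0 hΔN hTbE hTb'E hmono_b_Eq hmono_b'_Eq
  -- (3) margin: rise ≤ drop
  have hcomb := margin_combine (β := b' - b) (M := M) (K := 2 * a ^ 2 * ((Δ + p) * (a ^ 2 - c * q)))
    hβ hTp' (lt_of_lt_of_le hTbE hmono_b_Eq) (lt_of_lt_of_le hTb'E hmono_b'_Eq) hmargin
  have hK : (b' - b) * (2 * a ^ 2 * ((Δ + p) * (a ^ 2 - c * q))) = ((Δ + p) * (a ^ 2 - c * q)) * (2 * a ^ 2 * (b' - b)) := by ring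
  rw [hK] at hcomb
  have hsplit : fsRatio Δ a b' c E' - fsRatio Δ a b c E =
      (fsRatio Δ a b' c E' - fsRatio Δ a b' c E) + (fsRatio Δ a b' c E - fsRatio Δ a b c E) := by ring
  have hsum := add_le_add hrise hdrop
  rw [← hsplit, neg_div] at hsum
  have hfin : fsRatio Δ a b' c E' - fsRatio Δ a b c E ≤ 0 := by linarith only [hsum, hcomb]
  exact sub_nonpos.1 hfin

end TppMargin

/-! ## §3 The margin `t_pp′` lever -/

section TppPMargin

variable {Δ a b c c' ν p q M : ℝ}

/-- **THE MARGIN `t_pp′` LEVER**: at fixed `t_pp`, raising `t_pp′` from `c` to `c′` makes the fixed-doping `t′/t` more negative whenever the fixed-energy drop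
beats the energy-channel rise (`dopingDisc(θ′) ≤ M` on the window; `M = 0` on the cuprate side recovers §B.85 (m)). [folklore] -/
theorem fsRatio_fermiEnergyOf_anti_tppP_of_margin (hΔ : 0 < Δ) (ha : 0 < a) (hb : 0 < b) (hc : 0 ≤ c) (hcc : c ≤ c') (hcb : c' ≤ b)
    (hν0 : 0 < ν) (hν1 : ν < 1) (hp0 : 0 ≤ p) (hpE' : p ≤ fermiEnergyOf Δ a b c' ν) (hEq : fermiEnergyOf Δ a b c ν ≤ q)
    (hcapw : c' * (Δ + 2 * q) ≤ a ^ 2) (hM0 : 0 ≤ M) (hM : dopingDisc Δ a b c' q q ≤ M)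
    (hmargin : 4 * M * ((fsD Δ a c q + 2 * fsN a b c q) * (fsD Δ a c' q + 2 * fsN a b c' q)) ≤
      (((Δ + p) * (a ^ 2 - c * q)) * (2 * a ^ 2 - 2 * c' * q) + fsN a b c p * ((Δ + p) * p)) * (fsD Δ a c' p + 2 * fsN a b c' p) ^ 2) :
    fsRatio Δ a b c' (fermiEnergyOf Δ a b c' ν) ≤ fsRatio Δ a b c (fermiEnergyOf Δ a b c ν) := by
  set E := fermiEnergyOf Δ a b c ν with hE
  set E' := fermiEnergyOf Δ a b c' ν with hE'
  have hc' : 0 ≤ c' := hc.trans hcc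
  have hcb0 : c ≤ b := hcc.trans hcb
  have hγ : 0 ≤ c' - c := sub_nonneg.2 hcc
  -- the t_pp′ bracket of the Fermi energy (§B.85 (r)): E − 4γ ≤ E′ ≤ E
  have hbr := fermiEnergyOf_tppP_shift_mem_Icc (γ := c' - c) (b := b) hΔ ha.ne' hc hb.le hγ hν0 hν1
  rw [show c + (c' - c) = c' by ring, ← hE, ← hE'] at hbr
  obtain ⟨hE'E4, hE'E⟩ := hbr
  have hx0 : 0 ≤ E - E' := sub_nonneg.2 hE'E
  have hx : E - E' ≤ 4 * (c' - c) := by linarith only [hE'E4]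
  have hpE : p ≤ E := hpE'.trans hE'E
  have hE'q : E' ≤ q := hE'E.trans hEq
  have hpq : p ≤ q := hpE.trans hEq
  have hq0 : 0 ≤ q := hp0.trans hpq
  have hΔp : 0 ≤ Δ + p := by linarith only [hΔ, hp0]
  have hreg' : c' * q ≤ a ^ 2 := le_trans (mul_le_mul_of_nonneg_left (by linarith only [hΔ, hq0]) hc') hcapw
  have hreg : c * q ≤ a ^ 2 := le_trans (mul_le_mul_of_nonneg_right hcc hq0) hreg'
  have hcapw0 : c * (Δ + 2 * q) ≤ a ^ 2 := le_trans (mul_le_mul_of_nonneg_right hcc (by linarith only [hΔ, hq0])) hcapw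
  have hD0 : 0 ≤ (Δ + p) * (a ^ 2 - c * q) := mul_nonneg hΔp (by linarith only [hreg])
  have hD0' : 0 ≤ (Δ + p) * (a ^ 2 - c' * q) := mul_nonneg hΔp (by linarith only [hreg'])
  have hDE : (Δ + p) * (a ^ 2 - c * q) ≤ fsD Δ a c E := fsD_window_lower hc hΔp hreg hpE hEq
  have hD'p : 0 ≤ fsD Δ a c' p := le_trans hD0' (fsD_window_lower hc' hΔp hreg' le_rfl hpq)
  have hD'E : 0 ≤ fsD Δ a c' E := le_trans hD0' (fsD_window_lower hc' hΔp hreg' hpE hEq)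
  have hD'E' : 0 ≤ fsD Δ a c' E' := le_trans hD0' (fsD_window_lower hc' hΔp hreg' hpE' hE'q)
  have hNc'p : 0 < fsN a b c' p := fsN_pos ha.ne' hc' hcb hb hp0
  have hNcE : 0 < fsN a b c E := fsN_pos ha.ne' hc hcb0 hb (hp0.trans hpE)
  have hNc'E : 0 < fsN a b c' E := fsN_pos ha.ne' hc' hcb hb (hp0.trans hpE)
  have hNc'E' : 0 < fsN a b c' E' := fsN_pos ha.ne' hc' hcb hb (hp0.trans hpE')
  have hTc'p : 0 < fsD Δ a c' p + 2 * fsN a b c' p := by linarith only [hD'p, hNc'p]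
  have hTcE : 0 < fsD Δ a c E + 2 * fsN a b c E := by linarith only [hD0, hDE, hNcE]
  have hTc'E : 0 < fsD Δ a c' E + 2 * fsN a b c' E := by linarith only [hD'E, hNc'E]
  have hTc'E' : 0 < fsD Δ a c' E' + 2 * fsN a b c' E' := by linarith only [hD'E', hNc'E']
  have hm_c'_pE : fsD Δ a c' p + 2 * fsN a b c' p ≤ fsD Δ a c' E + 2 * fsN a b c' E := fsT_mono_on_window hc' hcb hcapw hpE hEq
  have hm_c'_pE' : fsD Δ a c' p + 2 * fsN a b c' p ≤ fsD Δ a c' E' + 2 * fsN a b c' E' := fsT_mono_on_window hc' hcb hcapw hpE' hE'q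
  have hm_c_Eq : fsD Δ a c E + 2 * fsN a b c E ≤ fsD Δ a c q + 2 * fsN a b c q := fsT_mono_on_window hc hcb0 hcapw0 hEq le_rfl
  have hm_c'_Eq : fsD Δ a c' E + 2 * fsN a b c' E ≤ fsD Δ a c' q + 2 * fsN a b c' q := fsT_mono_on_window hc' hcb hcapw hEq le_rfl
  -- (1) the energy channel at the row c′ (energy goes DOWN from E to E′): rise ≤ 4γM / T(c′; p)²
  have hdd : dopingDisc Δ a b c' E' E ≤ M :=
    (dopingDisc_mem_Icc_diag (Δ := Δ) (a := a) hc' hcb hp0 ⟨hpE', hE'q⟩ ⟨hpE, hEq⟩).2.trans hM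
  have hrise : fsRatio Δ a b c' E' - fsRatio Δ a b c' E ≤ 4 * (c' - c) * M / (fsD Δ a c' p + 2 * fsN a b c' p) ^ 2 := by
    have hform := fsRatio_sub_fsRatio_eq (Δ := Δ) (a := a) (b := b) (c := c') (ε₁ := E') (ε₂ := E) hTc'E'.ne' hTc'E.ne'
    have hrew : fsRatio Δ a b c' E' - fsRatio Δ a b c' E =
        (E - E') * dopingDisc Δ a b c' E' E / ((fsD Δ a c' E' + 2 * fsN a b c' E') * (fsD Δ a c' E + 2 * fsN a b c' E)) := by
      rw [← neg_sub, hform, neg_div, neg_neg]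
    rw [hrew]
    exact energyChannel_bound' hM0 hdd hx0 hx hTc'p hm_c'_pE' hm_c'_pE
  -- (2) the fixed-energy channel at E: drop ≥ γ·K / (T(c; q) T(c′; q))
  have hNE : fsN a b c p ≤ fsN a b c E := fsN_mono_energy hc hcb0 hpE
  have hN0 : 0 ≤ fsN a b c p := (fsN_pos ha.ne' hc hcb0 hb hp0).le
  have hA : 2 * a ^ 2 - 2 * c' * q ≤ 2 * a ^ 2 - E * (c + c') := by
    have h1 : E * (c + c') ≤ q * (2 * c') := mul_le_mul hEq (by linarith only [hcc]) (by linarith only [hc, hc']) hq0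
    linarith only [h1]
  have hA0 : 0 ≤ 2 * a ^ 2 - 2 * c' * q := by linarith only [hreg']
  have hB : (Δ + p) * p ≤ (Δ + E) * E := mul_le_mul (by linarith only [hpE]) hpE hp0 (by linarith only [hΔp, hpE])
  have hB0 : 0 ≤ (Δ + p) * p := mul_nonneg hΔp hp0
  have hKnn : 0 ≤ ((Δ + p) * (a ^ 2 - c * q)) * (2 * a ^ 2 - 2 * c' * q) + fsN a b c p * ((Δ + p) * p) :=
    add_nonneg (mul_nonneg hD0 hA0) (mul_nonneg hN0 hB0)
  have hcross : (c' - c) * (((Δ + p) * (a ^ 2 - c * q)) * (2 * a ^ 2 - 2 * c' * q) + fsN a b c p * ((Δ + p) * p)) ≤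
      fsN a b c' E * fsD Δ a c E - fsN a b c E * fsD Δ a c' E := by
    rw [cross_tppP_eq]
    have h1 : ((Δ + p) * (a ^ 2 - c * q)) * (2 * a ^ 2 - 2 * c' * q) ≤ fsD Δ a c E * (2 * a ^ 2 - E * (c + c')) :=
      mul_le_mul hDE hA hA0 (hD0.trans hDE)
    have h2 : fsN a b c p * ((Δ + p) * p) ≤ fsN a b c E * ((Δ + E) * E) := mul_le_mul hNE hB hB0 (hN0.trans hNE)
    have h3 := mul_le_mul_of_nonneg_left h1 hγ
    have h4 := mul_le_mul_of_nonneg_left h2 hγ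
    have e1 : fsD Δ a c E * ((c' - c) * (2 * a ^ 2 - E * (c + c'))) = (c' - c) * (fsD Δ a c E * (2 * a ^ 2 - E * (c + c'))) := by ring
    have e2 : fsN a b c E * ((Δ + E) * E * (c' - c)) = (c' - c) * (fsN a b c E * ((Δ + E) * E)) := by ring
    rw [e1, e2, mul_add]
    exact add_le_add h3 h4
  have hK0 : 0 ≤ (c' - c) * (((Δ + p) * (a ^ 2 - c * q)) * (2 * a ^ 2 - 2 * c' * q) + fsN a b c p * ((Δ + p) * p)) := mul_nonneg hγ hKnn
  have hdrop : fsRatio Δ a b c' E - fsRatio Δ a b c E ≤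
      -((c' - c) * (((Δ + p) * (a ^ 2 - c * q)) * (2 * a ^ 2 - 2 * c' * q) + fsN a b c p * ((Δ + p) * p))) /
        ((fsD Δ a c q + 2 * fsN a b c q) * (fsD Δ a c' q + 2 * fsN a b c' q)) := by
    rw [fsRatio_sub_fsRatio_tppP_at_eq hTcE.ne' hTc'E.ne']
    have h := fixedChannel_bound (D := fsN a b c' E * fsD Δ a c E - fsN a b c E * fsD Δ a c' E)
      (D₀ := (c' - c) * (((Δ + p) * (a ^ 2 - c * q)) * (2 * a ^ 2 - 2 * c' * q) + fsN a b c p * ((Δ + p) * p))) (n := 1) (n₀ := 1)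
      hK0 hcross zero_le_one le_rfl hTcE hTc'E hm_c_Eq hm_c'_Eq
    simpa only [mul_one] using h
  -- (3) margin
  have hcomb := margin_combine (β := c' - c) (M := M)
    (K := ((Δ + p) * (a ^ 2 - c * q)) * (2 * a ^ 2 - 2 * c' * q) + fsN a b c p * ((Δ + p) * p))
    hγ hTc'p (lt_of_lt_of_le hTcE hm_c_Eq) (lt_of_lt_of_le hTc'E hm_c'_Eq) hmargin
  have hsplit : fsRatio Δ a b c' E' - fsRatio Δ a b c E =
      (fsRatio Δ a b c' E' - fsRatio Δ a b c' E) + (fsRatio Δ a b c' E - fsRatio Δ a b c E) := by ring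
  have hsum := add_le_add hrise hdrop
  rw [← hsplit, neg_div] at hsum
  have hfin : fsRatio Δ a b c' E' - fsRatio Δ a b c E ≤ 0 := by linarith only [hsum, hcomb]
  exact sub_nonpos.1 hfin

end TppPMargin

end Summit.Ventures.CertifiedManyBodySolver.Downfold.Emery
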